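import Summits.BirchSwinnertonDyer.Rank1Residual.X10.ResidualSelmerLocalTerm
import Literature.NumberTheory.EllipticCurves.LocalIndexBadPoints
import Literature.NumberTheory.EllipticCurves.IwasawaSelmerControlAwayFromPProofs
import HarnessLib

/-!
# The `E[p]` instance of the N2 parity law, PART X: LOCAL RAMIFICATION of a Kummer class at a
# split `I_p` place — `κ_v(P) ∈ H¹_ur(K_v, E[p]) ↔ P ∈ E₀(K_v)` when `ord_v Δ_min = p`
# (cell `b2b-bsdres`, unit `b2b-bsdres-x10` = N2 class lead, GEN 32; TOOL — theorems only, no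
# definition, no named fact, nothing booked; the G-LOCAL lemma of `class-closure/N2/G-LOCAL-ASK-x10g32.md`,
# declined as a deal by n1011 R5-304 with pointers, built here on n1011's / the tree's local pieces)

HONEST FRAMING (run/shared/lean/b2b/bsd-rank1-residual/, verbatim in every file): the goal of the
cell is to DELETE the COMBINATION-SHAPED residual classes of the Birch–Swinnerton-Dyer formula for
ALL analytic-rank `≤ 1` elliptic curves over `ℚ` — "full BSD formula for every rank `≤ 1` curve in
class `C`" assembled STRICTLY from published theorems — so that the rank-`≤ 1` remainder becomes
exactly the CONSTRUCTION-SHAPED classes, which are TYPED (missing-input `Prop`s), NOT attempted.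
This is not "finishing BSD". Class X10b (= N2) keeps its label CONSTRUCTION-SHAPED (NEEDS `X_A3`,
referee R82.3 / RESIDUAL-MAP §I N2); this file is a TOOL; no mark / label / tier / count moves.

## What

For an elliptic curve `E = W` over a number field `K`, a prime `p`, a finite place `v ∤ p` of SPLIT
multiplicative reduction with `ord_v(Δ_min) = p` (Kodaira type `I_p`, so `c_v = p` and
`E(K_v)/E₀(K_v) ≅ ℤ/p`), and a point `P ∈ E(K_v)`:

**`localKummerMap_mem_unramifiedSubgroup_iff_hasNonsingularReduction`** — the local Kummer class
`κ_v(P) ∈ H¹(K_v, E[p])` is UNRAMIFIED iff `P` has NONSINGULAR reduction on the (chosen) local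
minimal model, i.e. `κ_v⁻¹(H¹_ur) = E₀(K_v)`.

Proof (the argument of PART IX `ResidualSelmerLocalTerm.natCard_kummerLocalConditionAt_eq_mul` with
the transport made explicit): `A := κ_v⁻¹(H¹_ur)` contains `E₀(K_v)` (a point of `E₀` has an
inertia-fixed `p`-th root in `E₀(K̄_v)` — `exists_nsmul_eq_fixed_of_reducesToNonsingular_of_tateNormalForm`
on the Tate normal form `J = D • (local minimal model)`, `D` over `𝓞_v`, and n1011's criterion
`localKummerMap_mem_unramifiedSubgroup_iff`), is proper (n1011's Kodaira–Néron witness), and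
`[E(K_v) : E₀(K_v)] = p` (the rational generator of `J(K_v^nr)/J₀ ≅ ℤ/p`,
`exists_rational_generator_of_tateNormalForm`, and `pE(K_v) ⊆ E₀(K_v)` since the quotient has
order `p`); hence `A = E₀(K_v)`. The identification of `E₀` across the models uses the tree's
`LocalIndex.hasNonsingularReduction_pointEquiv_iff` (an `𝓞_v`-change of variables preserves `E₀`,
Silverman VII.1.3(b)/VII.2) and `reducesToNonsingular_mapPoint_iff_of_tateNormalForm` (`E₀` of the
Tate normal form is absolute).

THE N2 READING (generator test (G), `X10/ResidualSelmerGeneratorTestInstance`,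
`X10/ResidualSelmerParityRat.generatorTest_of_rowCheck`, record `generatorTest_e118810j1`): at the
one `T`-prime `ℓ₀ = 5` of `118810j1` (`I₃` split, `p = 3`), the Kummer class of a point `P` is
ramified at `5` iff `P` reduces to the NODE — a coordinate computation on the minimal model.

References: [SilvermanAEC2009] VII.1 Prop. 1.3(b), VII.2 Prop. 2.1, VIII.2; [SilvermanATAEC1994]
IV.9 Cor. 9.2(d), V.4 Lemma 4.1.1; [MazurRubin2007] proof of Thm. 1.4; [GreenbergLNM1716] §3;
HOME/class-closure/N2/G-LOCAL-ASK-x10g32.md (+ ADDENDUM); HOME/X10-AUDIT.md §38.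
-/

set_option autoImplicit false

noncomputable section

open scoped Classical NNReal

open Function NumberField IsDedekindDomain Field WeierstrassCurve IsLocalRing
  Literature.NumberTheory.EllipticCurves Literature.NumberTheory.GaloisRepresentations
  IsDedekindDomain.HeightOneSpectrum
open Summit.BirchSwinnertonDyer.Rank1Residual.Additive
open Summit.BirchSwinnertonDyer.Rank1Residual.X10.ResidualSelmerLocalTerm

namespace Summit.BirchSwinnertonDyer.Rank1Residual.X10.ResidualSelmerLocalRamification

variable {K : Type} [Field K] [NumberField K]

/-! ### §1. The explicit transport `E(K̄_v) ≃+ X(K̄_v)` along `C • E_{K_v} = X` and its value on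
`K_v`-rational points -/

/-- The explicit transport of `E(K̄_v)` along a change of variables `C` over `K_v` with
`C • E_{K_v} = X` (the construction of the tree's `exists_addEquiv_localPoints_of_smul_eq`: two
identity transports around `VariableChange.pointEquivBaseChange`) is `Γ_{K_v}`-equivariant.
[cite: SilvermanAEC2009, VII.§1 and VIII.§1 (changes of variables over the ground field commute with Galois)] -/
theorem transport_smul (W : WeierstrassCurve K) (v : HeightOneSpectrum (𝓞 K))
    {X : WeierstrassCurve (v.adicCompletion K)} {C : VariableChange (v.adicCompletion K)}
    (hCM : C • W.baseChange (v.adicCompletion K) = X)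
    (σ : absoluteGaloisGroup (v.adicCompletion K)) (Q : localPoints W (v.adicCompletion K)) :
    (((Affine.Point.congrEquiv (baseChange_baseChange_adicCompletion W v).symm).trans
        (VariableChange.pointEquivBaseChange (W.baseChange (v.adicCompletion K)) C
          (AlgebraicClosure (v.adicCompletion K)))).trans
      (Affine.Point.congrEquiv (congrArg (fun Y : WeierstrassCurve (v.adicCompletion K) ↦
        Y.baseChange (AlgebraicClosure (v.adicCompletion K))) hCM))) (σ • Q) =
    Affine.Point.map ((absoluteGaloisGroup.toAlgEquiv _ σ :
        AlgebraicClosure (v.adicCompletion K) ≃ₐ[v.adicCompletion K]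
          AlgebraicClosure (v.adicCompletion K)) :
        AlgebraicClosure (v.adicCompletion K) →ₐ[v.adicCompletion K]
          AlgebraicClosure (v.adicCompletion K))
      ((((Affine.Point.congrEquiv (baseChange_baseChange_adicCompletion W v).symm).trans
        (VariableChange.pointEquivBaseChange (W.baseChange (v.adicCompletion K)) C
          (AlgebraicClosure (v.adicCompletion K)))).trans
      (Affine.Point.congrEquiv (congrArg (fun Y : WeierstrassCurve (v.adicCompletion K) ↦
        Y.baseChange (AlgebraicClosure (v.adicCompletion K))) hCM))) Q) := by
  change Affine.Point.congrEquiv _ (VariableChange.pointEquivBaseChange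
      (W.baseChange (v.adicCompletion K)) C (AlgebraicClosure (v.adicCompletion K))
      (Affine.Point.congrEquiv (baseChange_baseChange_adicCompletion W v).symm (σ • Q))) =
    Affine.Point.map _ (Affine.Point.congrEquiv _
      (VariableChange.pointEquivBaseChange (W.baseChange (v.adicCompletion K)) C
        (AlgebraicClosure (v.adicCompletion K))
        (Affine.Point.congrEquiv (baseChange_baseChange_adicCompletion W v).symm Q)))
  rw [congrEquiv_smul, VariableChange.pointEquivBaseChange_map_algEquiv]
  exact Affine.Point.congrEquiv_baseChange_map hCM _ _

/-- On a `K_v`-RATIONAL point `P` the transport is "substitute, then view in `K̄_v`":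
`Φ(P_{K̄_v}) = (C • P)_{K̄_v}` (both are the affine point `(u⁻²(x − r), u⁻³(y − s(x − r) − t))`
read in `K̄_v`; `map_toX_ringHom`). [cite: SilvermanAEC2009, III.1 Table 3.1] -/
theorem transport_toGeomPoints (W : WeierstrassCurve K) (v : HeightOneSpectrum (𝓞 K))
    {X : WeierstrassCurve (v.adicCompletion K)} {C : VariableChange (v.adicCompletion K)}
    (hCM : C • W.baseChange (v.adicCompletion K) = X)
    (hmap : X.map (algebraMap (v.adicCompletion K) (AlgebraicClosure (v.adicCompletion K))) =
      X.baseChange (AlgebraicClosure (v.adicCompletion K)))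
    (P : (W.baseChange (v.adicCompletion K)).toAffine.Point) :
    (((Affine.Point.congrEquiv (baseChange_baseChange_adicCompletion W v).symm).trans
        (VariableChange.pointEquivBaseChange (W.baseChange (v.adicCompletion K)) C
          (AlgebraicClosure (v.adicCompletion K)))).trans
      (Affine.Point.congrEquiv (congrArg (fun Y : WeierstrassCurve (v.adicCompletion K) ↦
        Y.baseChange (AlgebraicClosure (v.adicCompletion K))) hCM)))
      (W.baseChangeGeomPointsEquiv (v.adicCompletion K)
        ((W.baseChange (v.adicCompletion K)).toGeomPoints P)) =
    mapPoint (algebraMap (v.adicCompletion K) (AlgebraicClosure (v.adicCompletion K))) hmap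
      (Affine.Point.congrEquiv hCM (VariableChange.pointEquiv (W.baseChange (v.adicCompletion K)) C P)) := by
  rcases P with _ | ⟨x, y, h⟩
  · change Affine.Point.congrEquiv _ (VariableChange.pointEquivBaseChange
        (W.baseChange (v.adicCompletion K)) C (AlgebraicClosure (v.adicCompletion K))
        (Affine.Point.congrEquiv (baseChange_baseChange_adicCompletion W v).symm
          (W.baseChangeGeomPointsEquiv (v.adicCompletion K)
            ((W.baseChange (v.adicCompletion K)).toGeomPoints 0)))) =
      mapPoint _ hmap (Affine.Point.congrEquiv hCM
        (VariableChange.pointEquiv (W.baseChange (v.adicCompletion K)) C 0))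
    simp only [map_zero]
    erw [Affine.Point.congrEquiv_zero, map_zero]
  · subst hCM
    change Affine.Point.congrEquiv rfl (VariableChange.pointEquivBaseChange
        (W.baseChange (v.adicCompletion K)) C (AlgebraicClosure (v.adicCompletion K))
        (Affine.Point.congrEquiv (baseChange_baseChange_adicCompletion W v).symm
          (W.baseChangeGeomPointsEquiv (v.adicCompletion K)
            ((W.baseChange (v.adicCompletion K)).toGeomPoints (.some x y h))))) =
      mapPoint _ hmap (Affine.Point.congrEquiv rfl
        (VariableChange.pointEquiv (W.baseChange (v.adicCompletion K)) C (.some x y h)))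
    rw [show (W.baseChange (v.adicCompletion K)).toGeomPoints (.some x y h) =
        (.some (algebraMap _ _ x) (algebraMap _ _ y)
          ((Affine.map_nonsingular (W := W.baseChange (v.adicCompletion K)) (algebraMap
            (v.adicCompletion K) (AlgebraicClosure (v.adicCompletion K))).injective x y).mpr h) :
          geomPoints (W.baseChange (v.adicCompletion K))) from rfl]
    rw [baseChangeGeomPointsEquiv_some, Affine.Point.congrEquiv_some,
      VariableChange.pointEquivBaseChange_some, Affine.Point.congrEquiv_some,
      VariableChange.pointEquiv_some, Affine.Point.congrEquiv_some, mapPoint_some]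
    exact point_some_congr (map_toX_ringHom C _ x).symm (map_toY_ringHom C _ x y).symm

/-! ### §2. `κ_v⁻¹(H¹_ur) = E₀(K_v)` at a split `I_p` place -/

/-- **`κ_v(P)` is unramified iff `P ∈ E₀(K_v)`, at a split multiplicative `v ∤ p` with
`ord_v(Δ_min) = p`.** For an elliptic curve `E = W` over a number field `K`, a prime `p`, a finite
place `v ∤ p` of split multiplicative reduction with `ordMinimalDiscriminant v = p`, a change of
variables `C` over `K_v` onto the local minimal model (`C • E_{K_v} = W.localMinimalModel v`), and
`P ∈ E(K_v)`: the local Kummer class `κ_v(P) ∈ H¹(K_v, E[p])` lies in the unramified subgroup iff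
`C • P` has nonsingular reduction on the local minimal integral model. Hence `κ_v(P)` is RAMIFIED for
every point reducing to the node (the input of the generator test (G) at a `T`-prime with `c_v = p`).
No named fact. [cite: MazurRubin2007, proof of Thm. 1.4] [cite: SilvermanAEC2009, VII.1 Prop. 1.3(b) and VII.2 Prop. 2.1]
[cite: SilvermanATAEC1994, Cor. IV.9.2(d) (PDF p. 340)] -/
theorem localKummerMap_mem_unramifiedSubgroup_iff_hasNonsingularReduction
    (W : WeierstrassCurve K) [W.IsElliptic] (v : HeightOneSpectrum (𝓞 K)) {p : ℕ} [hp : Fact p.Prime]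
    (hpv : (p : 𝓞 K) ∉ v.asIdeal) (hsplit : W.HasSplitMultiplicativeReductionAt v)
    (hn : W.ordMinimalDiscriminant v = p) {C : VariableChange (v.adicCompletion K)}
    (hC : C • W.baseChange (v.adicCompletion K) = W.localMinimalModel v)
    (hp0 : ((p : ℕ) : ℤ) ≠ 0) (P : (W.baseChange (v.adicCompletion K)).toAffine.Point) :
    W.localKummerMap (v.adicCompletion K) hp0 P ∈
        DiscreteGaloisModule.unramifiedSubgroup
          ((W.torsionGaloisModule (p : ℤ)).restrictField (v.adicCompletion K)) 1 ↔
      (W.localMinimalIntegralModel v).HasNonsingularReduction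
        (Affine.Point.congrEquiv (hC.trans (W.map_localMinimalIntegralModel_eq (v := v)).symm)
          (VariableChange.pointEquiv (W.baseChange (v.adicCompletion K)) C P)) := by
  have hpp : p.Prime := hp.out
  haveI : CharZero (v.adicCompletion K) :=
    charZero_of_injective_algebraMap (algebraMap K (v.adicCompletion K)).injective
  obtain ⟨w, hw⟩ := v.exists_spectralValuation
  obtain ⟨𝔐, h𝔐⟩ := v.localPrimesAbove_nonempty
  have hv0 : w.Integers w.integer := Valuation.integer.integers w
  have hvO := integers_valuationRing_valuation (v.adicCompletionIntegers K) (v.adicCompletion K)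
  set U := DiscreteGaloisModule.unramifiedSubgroup
    ((W.torsionGaloisModule (p : ℤ)).restrictField (v.adicCompletion K)) 1 with hU
  set A : AddSubgroup (W.baseChange (v.adicCompletion K)).toAffine.Point :=
    U.comap (W.localKummerMap (v.adicCompletion K) hp0) with hA
  have hmemA : ∀ Q₀, Q₀ ∈ A ↔ ∃ Q : localPoints W (v.adicCompletion K),
      (p : ℤ) • Q = W.baseChangeGeomPointsEquiv (v.adicCompletion K)
        (toGeomPoints (W.baseChange (v.adicCompletion K)) Q₀) ∧
        ∀ τ ∈ absInertia (v.adicCompletion K), τ • Q = Q := fun Q₀ => by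
    rw [hA, AddSubgroup.mem_comap, hU, W.localKummerMap_mem_unramifiedSubgroup_iff hp0]
  /- (1) the local minimal integral model `I`, its Tate normal form `J = D • I` (`D` over `𝓞_v`),
  and `C' = D_K C` with `C' • E_{K_v} = J_{K_v}` -/
  set I := W.localMinimalIntegralModel v with hI
  have hCI : C • W.baseChange (v.adicCompletion K) = I.baseChange (v.adicCompletion K) :=
    hC.trans (W.map_localMinimalIntegralModel_eq (v := v)).symm
  obtain ⟨ϖ, hϖ⟩ := IsDiscreteValuationRing.exists_irreducible (v.adicCompletionIntegers K)
  obtain ⟨D, α, hn1, hDI, hDX⟩ := W.exists_variableChange_localMinimalModel_eq_tateNormalForm v hsplit hϖ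
  set n := W.ordMinimalDiscriminant v with hndef
  set J : WeierstrassCurve (v.adicCompletionIntegers K) := D • I with hJ
  have hJ1 : J.a₁ = 1 := by rw [hDI]
  have hJ2 : J.a₂ = 0 := by rw [hDI]
  have hJ3 : J.a₃ = 0 := by rw [hDI]
  have hJ4 : J.a₄ = 0 := by rw [hDI]
  have hJ6' : J.a₆ = (α : v.adicCompletionIntegers K) * ϖ ^ n := by rw [hDI]
  have h6 : J.a₆ ∈ maximalIdeal (v.adicCompletionIntegers K) := by
    rw [hJ6']
    exact Ideal.mul_mem_left _ _ (Ideal.pow_mem_of_mem _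
      ((IsLocalRing.mem_maximalIdeal _).mpr hϖ.not_isUnit) n hn1)
  set C' : VariableChange (v.adicCompletion K) := D.baseChange (v.adicCompletion K) * C with hC'def
  have hC' : C' • W.baseChange (v.adicCompletion K) = J.baseChange (v.adicCompletion K) := by
    rw [hC'def, mul_smul, hCI, hJ]
    exact LocalIndex.baseChange_smul_eq (K := v.adicCompletion K) I D
  haveI hJell : (J.baseChange (v.adicCompletion K)).IsElliptic := by rw [← hC']; infer_instance
  have hmapJ : (J.baseChange (v.adicCompletion K)).map
      (algebraMap (v.adicCompletion K) (AlgebraicClosure (v.adicCompletion K))) =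
      (J.baseChange (v.adicCompletion K)).baseChange (AlgebraicClosure (v.adicCompletion K)) := rfl
  /- (2) the explicit transport `Φ : E(K̄_v) ≃+ J(K̄_v)` and `g : E(K_v) → J(K̄_v)` -/
  have hCM' := congrArg (fun Y : WeierstrassCurve (v.adicCompletion K) ↦
    Y.baseChange (AlgebraicClosure (v.adicCompletion K))) hC'
  set Φ : localPoints W (v.adicCompletion K) ≃+
      ((J.baseChange (v.adicCompletion K)).baseChange (AlgebraicClosure (v.adicCompletion K))).toAffine.Point :=
    ((Affine.Point.congrEquiv (baseChange_baseChange_adicCompletion W v).symm).trans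
      (VariableChange.pointEquivBaseChange (W.baseChange (v.adicCompletion K)) C'
        (AlgebraicClosure (v.adicCompletion K)))).trans (Affine.Point.congrEquiv hCM') with hΦdef
  have hΦ : ∀ (σ : absoluteGaloisGroup (v.adicCompletion K)) (Q : localPoints W (v.adicCompletion K)),
      Φ (σ • Q) = Affine.Point.map ((absoluteGaloisGroup.toAlgEquiv _ σ :
          AlgebraicClosure (v.adicCompletion K) ≃ₐ[v.adicCompletion K]
            AlgebraicClosure (v.adicCompletion K)) :
          AlgebraicClosure (v.adicCompletion K) →ₐ[v.adicCompletion K]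
            AlgebraicClosure (v.adicCompletion K)) (Φ Q) :=
    fun σ Q => transport_smul W v hC' σ Q
  set g : (W.baseChange (v.adicCompletion K)).toAffine.Point →+
      ((J.baseChange (v.adicCompletion K)).baseChange (AlgebraicClosure (v.adicCompletion K))).toAffine.Point :=
    Φ.toAddMonoidHom.comp ((W.baseChangeGeomPointsEquiv (v.adicCompletion K)).toAddMonoidHom.comp
      (toGeomPoints (W.baseChange (v.adicCompletion K)))) with hg
  have hgapply : ∀ Q₀, g Q₀ = Φ (W.baseChangeGeomPointsEquiv (v.adicCompletion K)
      (toGeomPoints (W.baseChange (v.adicCompletion K)) Q₀)) := fun Q₀ => rfl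
  have hgP : ∀ Q₀, g Q₀ = mapPoint (algebraMap (v.adicCompletion K) (AlgebraicClosure (v.adicCompletion K)))
      hmapJ (Affine.Point.congrEquiv hC' (VariableChange.pointEquiv (W.baseChange (v.adicCompletion K)) C' Q₀)) :=
    fun Q₀ => transport_toGeomPoints W v hC' hmapJ Q₀
  have hgfix : ∀ Q₀ (σ : absoluteGaloisGroup (v.adicCompletion K)),
      Affine.Point.map ((absoluteGaloisGroup.toAlgEquiv _ σ :
          AlgebraicClosure (v.adicCompletion K) ≃ₐ[v.adicCompletion K]
            AlgebraicClosure (v.adicCompletion K)) :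
          AlgebraicClosure (v.adicCompletion K) →ₐ[v.adicCompletion K]
            AlgebraicClosure (v.adicCompletion K)) (g Q₀) = g Q₀ := fun Q₀ σ => by
    rw [hgP]; exact map_toAlgEquiv_mapPoint _ hmapJ _ σ
  /- (3) `E₀ ⊆ J(K̄_v)` and `E₀' = g⁻¹(E₀) ≤ E(K_v)`; `E₀'` membership = nonsingular reduction on `I` -/
  obtain ⟨W₀, hW₀, -⟩ := exists_integerModel_of_tateNormalForm hw J hJ1 hJ2 hJ3 hJ4 h6
  set E₀V := (W₀.nonsingularReductionSubgroup hv0).comap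
    (Affine.Point.congrEquiv hW₀.symm).toAddMonoidHom with hE₀V
  have hE₀Vmem : ∀ Q, Q ∈ E₀V ↔ ReducesToNonsingular w (residue w.integer) Q := fun Q => by
    rw [hE₀V, AddSubgroup.mem_comap, AddEquiv.coe_toAddMonoidHom,
      WeierstrassCurve.mem_nonsingularReductionSubgroup_iff,
      ← reducesToNonsingular_iff_hasNonsingularReduction W₀, reducesToNonsingular_congrEquiv_iff _ hW₀.symm]
  set E₀' : AddSubgroup (W.baseChange (v.adicCompletion K)).toAffine.Point := E₀V.comap g with hE₀'
  -- the two points of `J_{K_v} = (D • I)_{K_v}` obtained from `Q₀` agree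
  have hpts : ∀ Q₀ : (W.baseChange (v.adicCompletion K)).toAffine.Point,
      Affine.Point.congrEquiv hC' (VariableChange.pointEquiv (W.baseChange (v.adicCompletion K)) C' Q₀) =
        Affine.Point.congrEquiv (LocalIndex.baseChange_smul_eq I D)
          (VariableChange.pointEquiv (I.baseChange (v.adicCompletion K))
            (D.map (algebraMap (v.adicCompletionIntegers K) (v.adicCompletion K)))
            (Affine.Point.congrEquiv hCI (VariableChange.pointEquiv (W.baseChange (v.adicCompletion K)) C Q₀))) := by
    intro Q₀
    rcases Q₀ with _ | ⟨x, y, h⟩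
    · change Affine.Point.congrEquiv hC' (VariableChange.pointEquiv (W.baseChange (v.adicCompletion K)) C' 0) =
        Affine.Point.congrEquiv (LocalIndex.baseChange_smul_eq I D)
          (VariableChange.pointEquiv (I.baseChange (v.adicCompletion K))
            (D.map (algebraMap (v.adicCompletionIntegers K) (v.adicCompletion K)))
            (Affine.Point.congrEquiv hCI (VariableChange.pointEquiv (W.baseChange (v.adicCompletion K)) C 0)))
      simp only [map_zero]
    · rw [VariableChange.pointEquiv_some, Affine.Point.congrEquiv_some, VariableChange.pointEquiv_some,
        Affine.Point.congrEquiv_some, VariableChange.pointEquiv_some, Affine.Point.congrEquiv_some]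
      exact point_some_congr (toX_mul _ _ x) (toY_mul _ _ x y)
  have hE₀'iff : ∀ Q₀, Q₀ ∈ E₀' ↔ I.HasNonsingularReduction
      (Affine.Point.congrEquiv hCI (VariableChange.pointEquiv (W.baseChange (v.adicCompletion K)) C Q₀)) := by
    intro Q₀
    rw [hE₀', AddSubgroup.mem_comap, hE₀Vmem, hgP,
      reducesToNonsingular_mapPoint_iff_of_tateNormalForm hw J hJ1 hJ2 hJ3 hJ4 h6 hmapJ, hpts]
    exact LocalIndex.hasNonsingularReduction_pointEquiv_iff I D _
  /- (4) `E₀' ≤ A`: points of `E₀` have inertia-fixed `p`-th roots (PART IX §1) -/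
  have hE₀'A : E₀' ≤ A := fun Q₀ hQ₀ => by
    rw [hE₀', AddSubgroup.mem_comap, hE₀Vmem] at hQ₀
    obtain ⟨S, -, hpS, hSfix⟩ :=
      exists_nsmul_eq_fixed_of_reducesToNonsingular_of_tateNormalForm hw J hJ1 hJ2 hJ3 hJ4 h6 hpp hpv
        h𝔐 (g Q₀) (fun τ _ => hgfix Q₀ τ) hQ₀
    refine (hmemA Q₀).mpr ⟨Φ.symm S, Φ.injective ?_, fun τ hτ => Φ.injective ?_⟩
    · rw [map_zsmul, AddEquiv.apply_symm_apply, natCast_zsmul, hpS]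
      exact hgapply Q₀
    · rw [hΦ, AddEquiv.apply_symm_apply]
      exact hSfix τ (by rw [inertia_eq_absInertia hw h𝔐]; exact hτ)
  /- (5) `A ≠ ⊤` (the Kodaira–Néron witness) -/
  have hAtop : A ≠ ⊤ := by
    obtain ⟨Q₁, hQ₁⟩ :=
      exists_point_forall_absInertia_not_fixed_of_hasSplitMultiplicativeReductionAt_of_dvd W v hsplit
        (p := p) (dvd_of_eq (hn.symm.trans hndef))
    intro htop
    obtain ⟨Q, hQ, hfix⟩ := (hmemA Q₁).mp (htop ▸ AddSubgroup.mem_top Q₁)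
    obtain ⟨τ, hτ, hne⟩ := hQ₁ Q hQ
    exact hne (hfix τ hτ)
  /- (6) `[E(K_v) : E₀'] = p` from the rational generator of `J(K_v^nr)/J₀ ≅ ℤ/n`, `n = p` -/
  obtain ⟨gV, hgVfix, hgVord, hgVgen⟩ :=
    exists_rational_generator_of_tateNormalForm hw h𝔐 J hϖ hJ1 hJ2 hJ3 hJ4 α.isUnit hn1 hJ6'
  obtain ⟨Pstar, hPstar⟩ : ∃ Q₀, g Q₀ = gV := by
    have h1 : ∀ σ : absoluteGaloisGroup (v.adicCompletion K), σ • Φ.symm gV = Φ.symm gV :=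
      fun σ => Φ.injective (by rw [hΦ, AddEquiv.apply_symm_apply, hgVfix])
    have h2 : ∀ σ : absoluteGaloisGroup (v.adicCompletion K),
        σ • (W.baseChangeGeomPointsEquiv (v.adicCompletion K)).symm (Φ.symm gV) =
          (W.baseChangeGeomPointsEquiv (v.adicCompletion K)).symm (Φ.symm gV) := fun σ =>
      (W.baseChangeGeomPointsEquiv (v.adicCompletion K)).injective
        (by rw [W.baseChangeGeomPointsEquiv_smul, AddEquiv.apply_symm_apply, h1])
    obtain ⟨Q₀, hQ₀⟩ := exists_toGeomPoints_eq_of_forall_smul_eq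
      (W := W.baseChange (v.adicCompletion K)) h2
    exact ⟨Q₀, by rw [hgapply, hQ₀, AddEquiv.apply_symm_apply, AddEquiv.apply_symm_apply]⟩
  have hgen : ∀ Q₀, ∃ i : ℕ, Q₀ - i • Pstar ∈ E₀' := fun Q₀ => by
    obtain ⟨i, -, hi⟩ := hgVgen (g Q₀) (fun τ _ => hgfix Q₀ τ)
    refine ⟨i, ?_⟩
    rw [hE₀', AddSubgroup.mem_comap, map_sub, map_nsmul, hPstar, hE₀Vmem]
    exact hi
  have hord : ∀ i : ℕ, i • Pstar ∈ E₀' ↔ n ∣ i := fun i => by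
    rw [hE₀', AddSubgroup.mem_comap, map_nsmul, hPstar, hE₀Vmem]
    exact hgVord i
  have hpn : p ∣ n := dvd_of_eq hn.symm
  have hBidx := index_eq_of_generator E₀' Pstar hpn hgen hord
  -- `pE(K_v) ≤ E₀'` because `n = p`
  have hpE : (zsmulAddGroupHom (p : ℤ) : (W.baseChange (v.adicCompletion K)).toAffine.Point →+ _).range ≤
      E₀' := by
    rintro _ ⟨Q₀, rfl⟩
    obtain ⟨i, hi⟩ := hgen Q₀
    have h1 : (zsmulAddGroupHom (p : ℤ) : (W.baseChange (v.adicCompletion K)).toAffine.Point →+ _) Q₀ =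
        (p : ℕ) • (Q₀ - i • Pstar) + (p * i : ℕ) • Pstar := by
      change (p : ℤ) • Q₀ = _
      rw [mul_nsmul', nsmul_sub, sub_add_cancel, natCast_zsmul]
    rw [h1]
    exact E₀'.add_mem (E₀'.nsmul_mem hi p) ((hord _).mpr (by rw [← hn]; exact dvd_mul_right _ _))
  have hE₀'idx : E₀'.index = p := by
    have h := hBidx
    rwa [sup_eq_left.mpr hpE] at h
  /- (7) `A = E₀'`: both have index `p`, `E₀' ≤ A ≠ ⊤` -/
  have hAidx : A.index = p := by
    have hdvd : A.index ∣ p := hE₀'idx ▸ AddSubgroup.index_dvd_of_le hE₀'A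
    rcases (Nat.dvd_prime hpp).mp hdvd with h1 | h1
    · exact absurd (AddSubgroup.index_eq_one.mp h1) hAtop
    · exact h1
  have hAE : A = E₀' := by
    refine le_antisymm ?_ hE₀'A
    have h := AddSubgroup.relIndex_mul_index hE₀'A
    rw [hAidx, hE₀'idx] at h
    have h1 : E₀'.relIndex A = 1 :=
      Nat.eq_of_mul_eq_mul_right hpp.pos (h.trans (one_mul p).symm)
    exact AddSubgroup.relIndex_eq_one.mp h1
  -- conclusion
  change P ∈ A ↔ _
  rw [hAE]
  exact hE₀'iff P

end Summit.BirchSwinnertonDyer.Rank1Residual.X10.ResidualSelmerLocalRamification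

end
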